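import Mathlib
import Summits.ValiantsHypothesis.ValiantsHypothesis.Theorems.GrenetZeonPolySizeQPAlgebraJetRungs
import Summits.ValiantsHypothesis.ValiantsHypothesis.Theorems.GrenetZeonPolySizeQPAlgebraJetTransport
import Summits.ValiantsHypothesis.ValiantsHypothesis.Theorems.GrenetZeonPolySizeQPAlgebraHomogeneousLocalForm
import Summits.ValiantsHypothesis.ValiantsHypothesis.Theorems.GrenetZeonAbelianizationQPGorenstein
import HarnessLib

/-!
# Crux `GrenetZeon.PolySizeQPAlgebra` (stmt-ValiantsHypothesis-8064), line `vbp-slice-dealg` —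
# the corner `(n, ≤ 3)` of the `c = 1` box ⟸ ONE good `4`-space with threshold `6n`, BY NAME

Assembly of the hand's chain `…SpaceCriterion` → `…JetHessian` → `…JetRungs` → `…JetTransport` with the
tree's homogeneous local Frobenius normal form (`exists_homogeneous_local_frobenius_perPoly`,
`…HomogeneousLocalForm`): an `(n, 3)`-witness of `per_n` is a sum of pieces `λᵢ(det Lᵢ)` with `Lᵢ`
linear over local Frobenius algebras `Rᵢ`, `Σ dim Rᵢ ≤ 3`; a local Frobenius algebra of dimension
`r ≤ 3` is CURVILINEAR, `Rᵢ ≅ ℂ[ε]/ε^r` (`exists_basis_pow_of_finrank_le_three`: the socle is read by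
`λ`, `apply_ne_zero_of_socle`, so `𝔪² ≠ 0` in dimension `3`; nilpotency of `𝔪 = ker φ` does the
rest); each piece is then a jet form of order `r` with linear coefficient matrices
(`exists_jet_form_of_basis_pow`), and `perPoly_ne_sum_linear_jets_of_goodSpace` closes:

* `not_hasAlgDetRepr_perPoly_self_three_of_goodFourSpace` — **a good `4`-space with threshold `6n`
  at `n ≥ 1` gives `¬ HasAlgDetRepr per_n n 3`**; `…_of_le` — hence no `(m, s)`-representation with
  `m ≤ n`, `s ≤ 3`; `…_all_large` — good `4`-spaces for all large `n` empty the corner `(n, ≤ 3)` of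
  the `c = 1` box of the piece for all large `n` (verbatim `∃ R …` form: `polySizeQPAlgebra_one_corner_three_of_goodFourSpaces`).

So the EXACT remaining input for the rung `(n, 3)` is geometric: four linearly independent `n × n`
matrices on whose span every non-zero zero of `per_n` has `rank Hess per_n > 6n`, i.e.
`dim {p ∈ Z(per_n) : rank Hess per_n(p) ≤ 6n} ≤ n² - 4` — the dimension-`4`, LINEAR-threshold
analogue of the good planes of crux `HessianRankCodimTwo` (threshold `n²/2`, bordered Latin planes).
HONEST FRAMING: a conditional reduction; no stub of the line is closed; VP ≠ VNP is not moved.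

References: T. Mignon, N. Ressayre, IMRN 2004:79 [MignonRessayre2004]; P. Hrubeš, A. Yehudayoff,
Theory of Computing 7 (2011), §2 [HrubesYehudayoff2011].
-/

noncomputable section

open MvPolynomial Matrix
open Literature.Computability.AlgebraicComplexity

-- single-conjunct layout `Summits/ValiantsHypothesis/ValiantsHypothesis`: duplicated namespace by design
set_option linter.dupNamespace false

namespace Summit.ValiantsHypothesis.ValiantsHypothesis.Theorems.GrenetZeonPolySizeQPAlgebra

/-! ### Local Frobenius algebras of dimension `≤ 3` are curvilinear -/

section Curvilinear

variable {R : Type*} [CommRing R] [Algebra ℂ R]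

/-- If `y · x = c · y` with `x` nilpotent then `c = 0` or `y = 0` (`y x^k = c^k y`). [folklore] -/
theorem eq_zero_or_eq_zero_of_mul_eq_smul {y x : R} {c : ℂ} {s : ℕ} (h : y * x = c • y)
    (hs : x ^ s = 0) : c = 0 ∨ y = 0 := by
  have hk : ∀ k : ℕ, y * x ^ k = c ^ k • y := by
    intro k
    induction k with
    | zero => rw [pow_zero, pow_zero, mul_one, one_smul]
    | succ k ih => rw [pow_succ, ← mul_assoc, ih, smul_mul_assoc, h, smul_smul, ← pow_succ]
  have h0 : c ^ s • y = 0 := by rw [← hk s, hs, mul_zero]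
  rcases smul_eq_zero.1 h0 with hc | hy
  · exact Or.inl (pow_eq_zero_iff'.1 hc).1
  · exact Or.inr hy

omit [Algebra ℂ R] in
/-- If `x = x · x · u` with `x` nilpotent then `x = 0` (`x = x (xu)^k`). [folklore] -/
theorem eq_zero_of_eq_mul_mul_of_pow_eq_zero {x u : R} {s : ℕ} (h : x = x * x * u)
    (hs : x ^ s = 0) : x = 0 := by
  have hk : ∀ k : ℕ, x = x * (x * u) ^ k := by
    intro k
    induction k with
    | zero => rw [pow_zero, mul_one]
    | succ k ih =>
        calc x = x * (x * u) ^ k := ih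
          _ = x * x * u * (x * u) ^ k := by rw [← h]
          _ = x * (x * u) ^ (k + 1) := by rw [pow_succ']; ring
  rw [hk s, mul_pow, hs, zero_mul, mul_zero]

/-- Elements of a nilpotent character kernel are nilpotent. [folklore] -/
theorem pow_eq_zero_of_ker_pow_eq_bot (φ : R →ₐ[ℂ] ℂ) {s : ℕ}
    (hker : RingHom.ker (φ : R →+* ℂ) ^ s = ⊥) {x : R} (hx : φ x = 0) : x ^ s = 0 := by
  have hxm : x ∈ RingHom.ker (φ : R →+* ℂ) := by rwa [RingHom.mem_ker]
  have h := Ideal.pow_mem_pow hxm s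
  rwa [hker, Ideal.mem_bot] at h

variable [Module.Finite ℂ R]

/-- The kernel of a character has dimension `dim R - 1`. [folklore] -/
theorem finrank_ker_toLinearMap_add_one (φ : R →ₐ[ℂ] ℂ) :
    Module.finrank ℂ (LinearMap.ker φ.toLinearMap) + 1 = Module.finrank ℂ R := by
  have hsurj : LinearMap.range φ.toLinearMap = ⊤ := by
    rw [LinearMap.range_eq_top]
    intro c
    exact ⟨algebraMap ℂ R c, by simp⟩
  have h := LinearMap.finrank_range_add_finrank_ker φ.toLinearMap
  rw [hsurj, finrank_top, Module.finrank_self] at h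
  omega

omit [Module.Finite ℂ R] in
/-- **Dimension `1`: `R = ℂ`.** [folklore] -/
theorem exists_basis_pow_of_finrank_eq_one (φ : R →ₐ[ℂ] ℂ) (h1 : Module.finrank ℂ R = 1) :
    ∃ e : R, e ^ 1 = 0 ∧ ∃ b : Module.Basis (Fin 1) ℂ R, ∀ j, b j = e ^ (j : ℕ) := by
  have hnt : Nontrivial R := ⟨⟨1, 0, fun h10 => one_ne_zero ((map_one φ).symm.trans
    (by rw [h10, map_zero]))⟩⟩
  have hli : LinearIndependent ℂ (![(1 : R)] : Fin 1 → R) := by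
    rw [Fintype.linearIndependent_iff]
    intro g hg i
    fin_cases i
    simp only [Fin.sum_univ_one, Matrix.cons_val_fin_one] at hg
    simpa using congrArg φ hg
  refine ⟨0, pow_one 0, basisOfLinearIndependentOfCardEqFinrank hli (by simp [h1]), fun j => ?_⟩
  fin_cases j
  simp [coe_basisOfLinearIndependentOfCardEqFinrank]

/-- **Dimension `2`: `R = ℂ[ε]/ε²`** (local case: the kernel of `φ` is nilpotent). [folklore] -/
theorem exists_basis_pow_of_finrank_eq_two (φ : R →ₐ[ℂ] ℂ) {s : ℕ}
    (hker : RingHom.ker (φ : R →+* ℂ) ^ s = ⊥) (h2 : Module.finrank ℂ R = 2) :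
    ∃ e : R, e ^ 2 = 0 ∧ ∃ b : Module.Basis (Fin 2) ℂ R, ∀ j, b j = e ^ (j : ℕ) := by
  -- a non-zero element of the kernel
  have hK : Module.finrank ℂ (LinearMap.ker φ.toLinearMap) = 1 := by
    have := finrank_ker_toLinearMap_add_one φ; omega
  have hKne : LinearMap.ker φ.toLinearMap ≠ ⊥ := by
    intro h; rw [h, finrank_bot] at hK; exact zero_ne_one hK
  obtain ⟨e, heK, he0⟩ := Submodule.exists_mem_ne_zero_of_ne_bot hKne
  have hφe : φ e = 0 := by simpa using heK
  have hnil : e ^ s = 0 := pow_eq_zero_of_ker_pow_eq_bot φ hker hφe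
  -- `(1, e)` is a basis
  have hli : LinearIndependent ℂ (![(1 : R), e] : Fin 2 → R) := by
    rw [Fintype.linearIndependent_iff]
    intro g hg
    simp only [Fin.sum_univ_two, Matrix.cons_val_zero, Matrix.cons_val_one] at hg
    have hg0 : g 0 = 0 := by
      have := congrArg φ hg
      simpa [hφe] using this
    have hg1 : g 1 = 0 := by
      rw [hg0, zero_smul, zero_add] at hg
      exact (smul_eq_zero.1 hg).resolve_right he0
    intro i; fin_cases i <;> assumption
  set b := basisOfLinearIndependentOfCardEqFinrank hli (by simp [h2]) with hb
  have hbv : ∀ j, b j = (![(1 : R), e] : Fin 2 → R) j := fun j => by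
    rw [hb, coe_basisOfLinearIndependentOfCardEqFinrank]
  -- `e² = β e` forces `β = 0`
  have hsq : e ^ 2 = 0 := by
    have hrepr := b.sum_repr (e * e)
    rw [Fin.sum_univ_two, hbv, hbv] at hrepr
    simp only [Matrix.cons_val_zero, Matrix.cons_val_one] at hrepr
    have hα : b.repr (e * e) 0 = 0 := by
      have := congrArg φ hrepr
      simp only [map_add, map_smul, map_one, map_mul, hφe, smul_eq_mul, mul_zero, mul_one,
        add_zero] at this
      exact this
    rw [hα, zero_smul, zero_add] at hrepr
    rcases eq_zero_or_eq_zero_of_mul_eq_smul hrepr.symm hnil with hβ | he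
    · rw [pow_two, ← hrepr, hβ, zero_smul]
    · exact absurd he he0
  refine ⟨e, hsq, b, fun j => ?_⟩
  fin_cases j
  · simpa using hbv 0
  · simpa using hbv 1

/-- **Dimension `3`, Frobenius: `R = ℂ[ε]/ε³`.** With a nondegenerate functional `λ` (the local
Frobenius datum of the normal form) the square of the maximal ideal is non-zero — otherwise every
element of `𝔪 = ker φ` is a socle element, read non-trivially by `λ` (`apply_ne_zero_of_socle`), while
`λ` kills a non-zero element of the plane `𝔪` — so some `e ∈ 𝔪` has `e² ≠ 0`, and `(1, e, e²)` is a
basis with `e³ = 0`. [folklore] -/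
theorem exists_basis_pow_of_finrank_eq_three (φ : R →ₐ[ℂ] ℂ) {s : ℕ}
    (hker : RingHom.ker (φ : R →+* ℂ) ^ s = ⊥) (l : R →ₗ[ℂ] ℂ)
    (hl : ∀ x : R, (∀ y, l (y * x) = 0) → x = 0) (h3 : Module.finrank ℂ R = 3) :
    ∃ e : R, e ^ 3 = 0 ∧ ∃ b : Module.Basis (Fin 3) ℂ R, ∀ j, b j = e ^ (j : ℕ) := by
  set K : Submodule ℂ R := LinearMap.ker φ.toLinearMap with hKdef
  have hK : Module.finrank ℂ K = 2 := by
    have := finrank_ker_toLinearMap_add_one φ; rw [← hKdef] at this; omega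
  have hmemK : ∀ {x : R}, x ∈ K ↔ φ x = 0 := fun {x} => by
    rw [hKdef, LinearMap.mem_ker, AlgHom.toLinearMap_apply]
  -- some `e ∈ 𝔪` with `e² ≠ 0`
  have hex : ∃ e : R, φ e = 0 ∧ e * e ≠ 0 := by
    by_contra hcon
    push Not at hcon
    -- `𝔪² = 0`
    have hmm : ∀ x y : R, φ x = 0 → φ y = 0 → x * y = 0 := by
      intro x y hx hy
      have hxy : (x + y) * (x + y) = 0 := hcon _ (by rw [map_add, hx, hy, add_zero])
      have h2 : (2 : R) * (x * y) = 0 := by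
        have hx2 := hcon x hx
        have hy2 := hcon y hy
        linear_combination hxy - hx2 - hy2
      have hu : IsUnit (2 : R) := by
        have h := (IsUnit.mk0 (2 : ℂ) two_ne_zero).map (algebraMap ℂ R)
        rwa [map_ofNat] at h
      exact (hu.mul_right_eq_zero).1 h2
    -- a non-zero `x ∈ 𝔪` with `λ x = 0`
    set lK : K →ₗ[ℂ] ℂ := l.domRestrict K with hlK
    have hkerlK : LinearMap.ker lK ≠ ⊥ := by
      intro hbot
      have h1 := LinearMap.finrank_range_add_finrank_ker lK
      rw [hbot, finrank_bot, add_zero, hK] at h1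
      have h2 : Module.finrank ℂ (LinearMap.range lK) ≤ Module.finrank ℂ ℂ :=
        Submodule.finrank_le _
      rw [Module.finrank_self, h1] at h2
      omega
    obtain ⟨x, hxker, hx0⟩ := Submodule.exists_mem_ne_zero_of_ne_bot hkerlK
    have hlx : l (x : R) = 0 := by
      rw [LinearMap.mem_ker, hlK, LinearMap.domRestrict_apply] at hxker
      exact hxker
    have hx0' : (x : R) ≠ 0 := fun h => hx0 (Subtype.ext h)
    have hφx : φ (x : R) = 0 := hmemK.1 x.2
    have hsoc : ∀ z : R, φ z = 0 → z * (x : R) = 0 := fun z hz => hmm z x hz hφx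
    exact apply_ne_zero_of_socle φ l hl hsoc hx0' hlx
  obtain ⟨e, hφe, hee⟩ := hex
  have he0 : e ≠ 0 := fun h => hee (by rw [h, mul_zero])
  have hnil : e ^ s = 0 := pow_eq_zero_of_ker_pow_eq_bot φ hker hφe
  -- `(1, e, e²)` is linearly independent
  have hli : LinearIndependent ℂ (![(1 : R), e, e * e] : Fin 3 → R) := by
    rw [Fintype.linearIndependent_iff]
    intro g hg
    simp only [Fin.sum_univ_three, Matrix.cons_val_zero, Matrix.cons_val_one,
      Matrix.cons_val] at hg
    have hg0 : g 0 = 0 := by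
      have := congrArg φ hg
      simpa [hφe] using this
    rw [hg0, zero_smul, zero_add] at hg
    -- `β e + γ e² = 0`
    have hg1 : g 1 = 0 := by
      by_contra hβ
      -- `e = -(γ/β) e²`, so `e = e·e·u` with `u` a scalar: `e = 0`
      have he : e = e * e * algebraMap ℂ R (-(g 2 / g 1)) := by
        have h2 : g 1 • e = -(g 2 • (e * e)) := eq_neg_of_add_eq_zero_left hg
        calc e = (g 1)⁻¹ • (g 1 • e) := by rw [smul_smul, inv_mul_cancel₀ hβ, one_smul]
          _ = (-(g 2 / g 1)) • (e * e) := by rw [h2, smul_neg, smul_smul, ← neg_smul, div_eq_inv_mul]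
          _ = e * e * algebraMap ℂ R (-(g 2 / g 1)) := by rw [Algebra.smul_def, mul_comm]
      exact he0 (eq_zero_of_eq_mul_mul_of_pow_eq_zero he hnil)
    rw [hg1, zero_smul, zero_add] at hg
    have hg2 : g 2 = 0 := (smul_eq_zero.1 hg).resolve_right hee
    intro i; fin_cases i <;> assumption
  set b := basisOfLinearIndependentOfCardEqFinrank hli (by simp [h3]) with hb
  have hbv : ∀ j, b j = (![(1 : R), e, e * e] : Fin 3 → R) j := fun j => by
    rw [hb, coe_basisOfLinearIndependentOfCardEqFinrank]
  -- `e³ = β e + γ e²` forces `β = γ = 0`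
  have hcube : e ^ 3 = 0 := by
    have hrepr := b.sum_repr (e * e * e)
    rw [Fin.sum_univ_three, hbv, hbv, hbv] at hrepr
    simp only [Matrix.cons_val_zero, Matrix.cons_val_one, Matrix.cons_val] at hrepr
    have hα : b.repr (e * e * e) 0 = 0 := by
      have := congrArg φ hrepr
      simp only [map_add, map_smul, map_one, map_mul, hφe, smul_eq_mul, mul_zero, mul_one,
        add_zero] at this
      exact this
    rw [hα, zero_smul, zero_add] at hrepr
    set β := b.repr (e * e * e) 1
    set γ := b.repr (e * e * e) 2
    have hβ : β = 0 := by
      by_contra hβ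
      -- `e = e² (β⁻¹ (e - γ))`: so `e = 0`
      have he : e = e * e * (β⁻¹ • (e - algebraMap ℂ R γ)) := by
        have h1 : β • e = e * e * e - γ • (e * e) := by rw [← hrepr]; abel
        calc e = β⁻¹ • (β • e) := by rw [smul_smul, inv_mul_cancel₀ hβ, one_smul]
          _ = β⁻¹ • (e * e * e - γ • (e * e)) := by rw [h1]
          _ = e * e * (β⁻¹ • (e - algebraMap ℂ R γ)) := by
              rw [mul_smul_comm, mul_sub, Algebra.smul_def γ, mul_comm (algebraMap ℂ R γ) (e * e)]
      exact he0 (eq_zero_of_eq_mul_mul_of_pow_eq_zero he hnil)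
    rw [hβ, zero_smul, zero_add] at hrepr
    -- `e² · e = γ e²`: `γ = 0`
    rcases eq_zero_or_eq_zero_of_mul_eq_smul hrepr.symm hnil with hγ | he2
    · rw [pow_succ, pow_two, ← hrepr, hγ, zero_smul]
    · exact absurd he2 hee
  refine ⟨e, hcube, b, fun j => ?_⟩
  fin_cases j
  · simpa using hbv 0
  · simpa using hbv 1
  · simpa [pow_two] using hbv 2

/-- **Local Frobenius algebras of dimension `r ≤ 3` are curvilinear:** a basis `(1, e, …, e^{r-1})`
with `e^r = 0`. [folklore] -/
theorem exists_basis_pow_of_finrank_le_three (φ : R →ₐ[ℂ] ℂ) {s : ℕ}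
    (hker : RingHom.ker (φ : R →+* ℂ) ^ s = ⊥) (l : R →ₗ[ℂ] ℂ)
    (hl : ∀ x : R, (∀ y, l (y * x) = 0) → x = 0) {r : ℕ} (hr : Module.finrank ℂ R = r)
    (h1 : 1 ≤ r) (h3 : r ≤ 3) :
    ∃ e : R, e ^ r = 0 ∧ ∃ b : Module.Basis (Fin r) ℂ R, ∀ j, b j = e ^ (j : ℕ) := by
  interval_cases r
  · exact exists_basis_pow_of_finrank_eq_one φ hr
  · exact exists_basis_pow_of_finrank_eq_two φ hker hr
  · exact exists_basis_pow_of_finrank_eq_three φ hker l hl hr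

end Curvilinear

/-! ### The corner `(n, ≤ 3)` from a good `4`-space -/

section Corner

/-- **The rung `(n, 3)` BY NAME from one good `4`-space with threshold `6n`.** If four linearly
independent `n × n` matrices span a space on which every non-zero zero of `per_n` has
`rank Hess per_n > 6n` (`n ≥ 1`), then `per_n` has NO `(n, 3)`-representation:
`¬ HasAlgDetRepr per_n n 3`.  Proof: homogeneous local Frobenius normal form; every piece has
dimension `1 ≤ rᵢ ≤ 3`, hence is curvilinear (`exists_basis_pow_of_finrank_le_three`) and a jet form of
order `rᵢ` with linear coefficient matrices (`exists_jet_form_of_basis_pow`); `Σ rᵢ ≤ 3 < 4` and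
`Σ 2rᵢn ≤ 6n`, so `perPoly_ne_sum_linear_jets_of_goodSpace` applies. [cite: MignonRessayre2004, §2] -/
theorem not_hasAlgDetRepr_perPoly_self_three_of_goodFourSpace {n : ℕ} (hn : 1 ≤ n)
    (hW : ∃ w : Fin 4 → (Fin n × Fin n → ℂ), LinearIndependent ℂ w ∧
      ∀ a : Fin 4 → ℂ, a ≠ 0 → eval (∑ i, a i • w i) (perPoly (Fin n) ℂ) = 0 →
        6 * n < (hess0 (transl (∑ i, a i • w i) (perPoly (Fin n) ℂ))).rank) :
    ¬ HasAlgDetRepr (perPoly (Fin n) ℂ) n 3 := by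
  classical
  intro h
  obtain ⟨t, F, dim, -, hdim, hper, -, hloc⟩ := exists_homogeneous_local_frobenius_perPoly h
  -- every piece is a jet form of order `dim i` with linear coefficient matrices
  have key : ∀ i : Fin t, 1 ≤ dim i ∧
      ∃ (M : Matrix (Fin n) (Fin n) (Polynomial (MvPolynomial (Fin n × Fin n) ℂ))) (w : ℕ → ℂ),
        (∀ a b c, ((M a b).coeff c).IsHomogeneous 1) ∧
          F i = ∑ j ∈ Finset.range (dim i), C (w j) * M.det.coeff j := by
    intro i
    obtain ⟨R, _, _, _, φ, hker, hdimR, l, A, hA, hcoeff, hnondeg⟩ := hloc i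
    have hnt : Nontrivial R := ⟨⟨1, 0, fun h10 => one_ne_zero ((map_one φ).symm.trans
      (by rw [h10, map_zero]))⟩⟩
    have h1 : 1 ≤ dim i := by rw [← hdimR]; exact Module.finrank_pos
    have h3 : dim i ≤ 3 :=
      (Finset.single_le_sum (fun j _ => Nat.zero_le (dim j)) (Finset.mem_univ i)).trans hdim
    obtain ⟨e, he, b, hb⟩ := exists_basis_pow_of_finrank_le_three φ hker l hnondeg hdimR h1 h3
    obtain ⟨M, -, hMhom, hF⟩ := exists_jet_form_of_basis_pow e he b hb l A (F i) hcoeff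
    exact ⟨h1, M, fun j => l (e ^ j), fun a b' c => hMhom a b' c 1 (hA a b'), hF⟩
  choose hpos M w hMlin hMF using key
  have hsum : perPoly (Fin n) ℂ = ∑ u, ∑ j ∈ Finset.range (dim u), C (w u j) * (M u).det.coeff j := by
    rw [hper]
    exact Finset.sum_congr rfl fun u _ => hMF u
  refine perPoly_ne_sum_linear_jets_of_goodSpace hW dim (fun _ => n) hpos (fun _ => hn)
    (by omega) ?_ M hMlin w hsum
  rw [← Finset.sum_mul]
  calc (∑ u, dim u) * (2 * n) ≤ 3 * (2 * n) := Nat.mul_le_mul_right _ hdim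
    _ = 6 * n := by ring

/-- Monotone form: a good `4`-space with threshold `6n` at `n ≥ 1` excludes every
`(m, s)`-representation of `per_n` with `m ≤ n` and `s ≤ 3` (`HasAlgDetRepr.mono`). [folklore] -/
theorem not_hasAlgDetRepr_perPoly_of_le_three_of_goodFourSpace {n : ℕ} (hn : 1 ≤ n)
    (hW : ∃ w : Fin 4 → (Fin n × Fin n → ℂ), LinearIndependent ℂ w ∧
      ∀ a : Fin 4 → ℂ, a ≠ 0 → eval (∑ i, a i • w i) (perPoly (Fin n) ℂ) = 0 →
        6 * n < (hess0 (transl (∑ i, a i • w i) (perPoly (Fin n) ℂ))).rank)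
    {m s : ℕ} (hm : m ≤ n) (hs : s ≤ 3) : ¬ HasAlgDetRepr (perPoly (Fin n) ℂ) m s :=
  fun h => not_hasAlgDetRepr_perPoly_self_three_of_goodFourSpace hn hW (h.mono hm hs)

/-- **All large `n`.** Good `4`-spaces with threshold `6n` for all large `n` empty the corner
`(m, s) ≤ (n, 3)` of the `c = 1` box of the piece for all large `n`. [folklore] -/
theorem not_hasAlgDetRepr_perPoly_le_three_all_large
    (hW : ∃ n₀ : ℕ, ∀ n ≥ n₀, ∃ w : Fin 4 → (Fin n × Fin n → ℂ), LinearIndependent ℂ w ∧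
      ∀ a : Fin 4 → ℂ, a ≠ 0 → eval (∑ i, a i • w i) (perPoly (Fin n) ℂ) = 0 →
        6 * n < (hess0 (transl (∑ i, a i • w i) (perPoly (Fin n) ℂ))).rank) :
    ∃ n₀ : ℕ, ∀ n ≥ n₀, ∀ m s : ℕ, m ≤ n → s ≤ 3 → ¬ HasAlgDetRepr (perPoly (Fin n) ℂ) m s := by
  obtain ⟨n₀, h⟩ := hW
  exact ⟨max n₀ 1, fun n hn m s hm hs =>
    not_hasAlgDetRepr_perPoly_of_le_three_of_goodFourSpace (le_of_max_le_right hn)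
      (h n (le_of_max_le_left hn)) hm hs⟩

/-- **Reading for the piece `PolySizeQPAlgebra` (stmt-8064), `c = 1` box, verbatim `∃ R …` form:**
good `4`-spaces with threshold `6n` for all large `n` imply that for all large `n` the point
`(m, s) = (n, 3)` carries no representation of `per_n`. [folklore] -/
theorem polySizeQPAlgebra_one_corner_three_of_goodFourSpaces
    (hW : ∃ n₀ : ℕ, ∀ n ≥ n₀, ∃ w : Fin 4 → (Fin n × Fin n → ℂ), LinearIndependent ℂ w ∧
      ∀ a : Fin 4 → ℂ, a ≠ 0 → eval (∑ i, a i • w i) (perPoly (Fin n) ℂ) = 0 →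
        6 * n < (hess0 (transl (∑ i, a i • w i) (perPoly (Fin n) ℂ))).rank) :
    ∃ n₀ : ℕ, ∀ n ≥ n₀, ¬ (∃ (R : Type) (_ : CommRing R) (_ : Algebra ℂ R) (_ : Module.Finite ℂ R),
      Module.finrank ℂ R ≤ 3 ∧ ∃ (l : R →ₗ[ℂ] ℂ)
        (A : Matrix (Fin n) (Fin n) (MvPolynomial (Fin n × Fin n) R)),
        (∀ i j, (A i j).totalDegree ≤ 1) ∧ ∀ d : (Fin n × Fin n) →₀ ℕ,
          l (MvPolynomial.coeff d A.det) = MvPolynomial.coeff d (perPoly (Fin n) ℂ)) := by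
  obtain ⟨n₀, h⟩ := not_hasAlgDetRepr_perPoly_le_three_all_large hW
  exact ⟨n₀, fun n hn => h n hn n 3 le_rfl le_rfl⟩

end Corner

end Summit.ValiantsHypothesis.ValiantsHypothesis.Theorems.GrenetZeonPolySizeQPAlgebra

end
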